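import Summits.AtomisticToContinuum.FouriersLaw.Theorems.BondHeatUncertaintyExtensiveSnapshotIrreversibilityEnergyWindowDilationDuhamelA

/-!
# DilationDuhamel (part W): the dilation commutator identity, kernel-side abbreviations, the five pieces (Dᵛ)/(EBᵃ)/(EBᵈ)/(XBⁿ)/(XBᶠ) and the junction — part 2 of 3 (sequel of `…BondHeatUncertaintyExtensiveSnapshotIrreversibilityEnergyWindowDilationDuhamelA`)

Split for the 400-line cap by the landing lane (hand-2 g33); the module docstring of part 1 (`…BondHeatUncertaintyExtensiveSnapshotIrreversibilityEnergyWindowDilationDuhamelA`) describes the whole node.  Same namespace; all FQNs unchanged.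
0 sorry; standard axioms.
-/

noncomputable section

namespace Summit.AtomisticToContinuum.FouriersLaw.Theorems.ExtensiveSnapshotIrreversibility.EnergyWindow

open MeasureTheory Filter Topology Real intervalIntegral
open scoped ENNReal NNReal ContDiff
open Literature.MathematicalPhysics.KineticTheory.HeatConduction
open Literature.Probability.Process

variable {N : ℕ}

section Commutator

variable (P : OscillatorChain) (hU : ContDiff ℝ ∞ P.U) (hV : ContDiff ℝ ∞ P.V)
include hU hV

/-- `∂_{p_b}(Df·Y) = D(∂_{p_b} f)·Y + Df·(DY e_{p_b})` for smooth `f` and the drift `Y`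
(Leibniz + symmetry of `D²f`). [folklore] -/
theorem partialP_fderiv_drift {f : PhaseSpace N → ℝ} (hf : ContDiff ℝ ∞ f) (b : Fin N)
    (x : PhaseSpace N) :
    partialP b (fun y => fderiv ℝ f y (P.drift N y)) x =
      fderiv ℝ (partialP b f) x (P.drift N x) +
        fderiv ℝ f x (fderiv ℝ (P.drift N) x ((0 : Fin N → ℝ), Pi.single b 1)) := by
  have hfd : Differentiable ℝ f := hf.differentiable (by simp)
  have hf2 : ContDiff ℝ 2 f := hf.of_le (by norm_cast)
  have hYC : ContDiff ℝ ∞ (P.drift N) := P.contDiff_drift hU hV N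
  have hYd : Differentiable ℝ (P.drift N) := hYC.differentiable (by simp)
  have hcC : ContDiff ℝ ∞ (fderiv ℝ f) := hf.fderiv_right (m := ∞) (by simp)
  have hcd : Differentiable ℝ (fderiv ℝ f) := hcC.differentiable (by simp)
  have hF : Differentiable ℝ (fun y => fderiv ℝ f y (P.drift N y)) :=
    (hcC.clm_apply hYC).differentiable (by simp)
  rw [partialP_eq_fderiv hF b]
  simp only
  rw [fderiv_clm_apply (hcd x) (hYd x)]
  simp only [add_apply, ContinuousLinearMap.comp_apply, ContinuousLinearMap.flip_apply]
  rw [partialP_eq_fderiv hfd b, (hasFDerivAt_fderiv_apply hf2 x _).fderiv,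
    ContinuousLinearMap.flip_apply, fderiv_fderiv_symm hf2 x _ (P.drift N x), add_comm]

/-- `Df(x)·(DY(x) e_{p_b}) = ∂_{q_b} f (x) − γ 1_B(b) ∂_{p_b} f (x)`
(`DY e_{p_b} = e_{q_b} − γ 1_B(b) e_{p_b}`, `fderiv_drift_apply`). [folklore] -/
theorem fderiv_apply_fderiv_drift_unitP {f : PhaseSpace N → ℝ} (hf : Differentiable ℝ f)
    (b : Fin N) (x : PhaseSpace N) :
    fderiv ℝ f x (fderiv ℝ (P.drift N) x ((0 : Fin N → ℝ), Pi.single b 1)) =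
      partialQ b f x - P.γ * OscillatorChain.bathWeight N b * partialP b f x := by
  rw [P.fderiv_drift_apply hU hV N x]
  have hv : ((Pi.single b (1 : ℝ) : Fin N → ℝ), fun i : Fin N =>
        -(∑ j, P.hessPotential N i j x.1 * (0 : Fin N → ℝ) j) -
          P.γ * OscillatorChain.bathWeight N i * (Pi.single b (1 : ℝ) : Fin N → ℝ) i) =
      ((Pi.single b 1, 0) : PhaseSpace N) +
        (-(P.γ * OscillatorChain.bathWeight N b)) •
          (((0 : Fin N → ℝ), Pi.single b 1) : PhaseSpace N) := by
    ext i
    · simp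
    · by_cases h : i = b
      · subst h; simp
      · simp [h]
  rw [hv, map_add, map_smul, partialQ_eq_fderiv hf b, partialP_eq_fderiv hf b]
  simp only [smul_eq_mul]
  ring

/-- ★ **The dilation commutator identity.**  For a chain with smooth potentials, every site `b`,
smooth `f`, all temperatures and every point:
`[L, D_b] f = 2 γ c_b ∂²_{p_b} f − 𝒜_b f`, where `D_b f = p_b ∂_{p_b} f` is the momentum dilation,
`c_b = [b = 0] T_L + [b = N−1] T_R` the bath coefficient, and
`𝒜_b f = p_b ∂_{q_b} f + (∂_{q_b}H) ∂_{p_b} f` the bath exchange operator.  (The friction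
`−γ p_b ∂_{p_b}` commutes with `D_b`; the noise gives `[T ∂²_p, p ∂_p] = 2T ∂²_p`; the Hamiltonian
field gives `−𝒜_b`; the third-order terms cancel by symmetry of `D³ f`.)
(after BakryEmery1985, carré du champ) [folklore] -/
theorem generator_momDilation_sub (T_L T_R : ℝ) {f : PhaseSpace N → ℝ} (hf : ContDiff ℝ ∞ f)
    (b : Fin N) (x : PhaseSpace N) :
    P.generator N T_L T_R (momDilation b f) x - momDilation b (P.generator N T_L T_R f) x =
      2 * P.γ * bathCoeff N T_L T_R b * partialP b (partialP b f) x - bathExchange P N b f x := by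
  -- smoothness bookkeeping
  have hfd : Differentiable ℝ f := hf.differentiable (by simp)
  have hf2 : ContDiff ℝ 2 f := hf.of_le (by norm_cast)
  have hgC : ContDiff ℝ ∞ (partialP b f) := contDiff_partialP (m := ∞) hf (by simp) b
  have hgd : Differentiable ℝ (partialP b f) := hgC.differentiable (by simp)
  have hmC : ContDiff ℝ ∞ (fun y : PhaseSpace N => y.2 b) := contDiff_momentum_coord b
  have hmd : Differentiable ℝ (fun y : PhaseSpace N => y.2 b) := hmC.differentiable (by simp)
  have hffC : ∀ i, ContDiff ℝ ∞ (partialP i f) := fun i =>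
    contDiff_partialP (m := ∞) hf (by simp) i
  have hff2 : ∀ i, ContDiff ℝ 2 (partialP i f) := fun i => (hffC i).of_le (by norm_cast)
  have hfiiC : ∀ i, ContDiff ℝ ∞ (partialP i (partialP i f)) := fun i =>
    contDiff_partialP (m := ∞) (hffC i) (by simp) i
  have hfiid : ∀ i, Differentiable ℝ (partialP i (partialP i f)) := fun i =>
    (hfiiC i).differentiable (by simp)
  have hgiC : ∀ i, ContDiff ℝ ∞ (partialP i (partialP b f)) := fun i =>
    contDiff_partialP (m := ∞) hgC (by simp) i
  have hgid : ∀ i, Differentiable ℝ (partialP i (partialP b f)) := fun i =>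
    (hgiC i).differentiable (by simp)
  have hYC : ContDiff ℝ ∞ (P.drift N) := P.contDiff_drift hU hV N
  have hDdef : momDilation b f = (fun y : PhaseSpace N => y.2 b) * partialP b f := rfl
  have hDC : ContDiff ℝ ∞ (momDilation b f) := by rw [hDdef]; exact hmC.mul hgC
  have hDd : Differentiable ℝ (momDilation b f) := hDC.differentiable (by simp)
  -- the drift and noise parts of `L f` as functions
  have hF₁d : Differentiable ℝ (fun y => fderiv ℝ f y (P.drift N y)) :=
    ((hf.fderiv_right (m := ∞) (by simp)).clm_apply hYC).differentiable (by simp)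
  have hF₂d : Differentiable ℝ
      (fun y => ∑ i, bathCoeff N T_L T_R i * partialP i (partialP i f) y) := by fun_prop
  have hLf : P.generator N T_L T_R f = fun y => fderiv ℝ f y (P.drift N y) +
      P.γ * ∑ i, bathCoeff N T_L T_R i * partialP i (partialP i f) y := by
    funext y; rw [P.generator_eq_fderiv_drift_add N T_L T_R hfd y]; rfl
  -- first derivatives of `D_b f`
  have hDi : ∀ i, partialP i (momDilation b f) =
      fun y => y.2 b * partialP i (partialP b f) y + (if b = i then partialP b f y else 0) := by
    intro i; funext y
    rw [hDdef, partialP_mul hmd hgd, partialP_momentum_coord]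
    split_ifs <;> simp
  -- second derivatives of `D_b f`
  have hDii : ∀ i, partialP i (partialP i (momDilation b f)) x =
      x.2 b * partialP i (partialP i (partialP b f)) x +
        2 * (if b = i then partialP i (partialP b f) x else 0) := by
    intro i
    rw [hDi i]
    by_cases hb : b = i
    · subst hb
      simp only [if_true]
      have hd1 : Differentiable ℝ
          (fun y : PhaseSpace N => y.2 b * partialP b (partialP b f) y) := by
        have := hgid b; fun_prop
      rw [Summit.AtomisticToContinuum.FouriersLaw.Theorems.OddSectorIrreversibility.partialP_add hd1 hgd,
        show (fun y : PhaseSpace N => y.2 b * partialP b (partialP b f) y) =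
          (fun y : PhaseSpace N => y.2 b) * partialP b (partialP b f) from rfl,
        partialP_mul hmd (hgid b), partialP_momentum_coord]
      simp only [if_true]
      ring
    · simp only [hb, if_false, add_zero]
      rw [show (fun y : PhaseSpace N => y.2 b * partialP i (partialP b f) y) =
          (fun y : PhaseSpace N => y.2 b) * partialP i (partialP b f) from rfl,
        partialP_mul hmd (hgid i), partialP_momentum_coord]
      simp [hb]
  -- symmetry `∂_i ∂_b f = ∂_b ∂_i f` and the third-order `∂_i ∂_i ∂_b f = ∂_b ∂_i ∂_i f`
  have hmixed : ∀ i, partialP i (partialP b f) = partialP b (partialP i f) := fun i =>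
    partialP_partialP_swap hf2 i b
  have hthird : ∀ i, partialP i (partialP i (partialP b f)) =
      partialP b (partialP i (partialP i f)) := by
    intro i
    rw [hmixed i]
    exact partialP_partialP_swap (hff2 i) i b
  -- `L (D_b f)` at `x`
  have hLD : P.generator N T_L T_R (momDilation b f) x =
      x.2 b * fderiv ℝ (partialP b f) x (P.drift N x) +
        partialP b f x * (-partialQ b (P.hamiltonian N) x -
          P.γ * OscillatorChain.bathWeight N b * x.2 b) +
        P.γ * ∑ i, bathCoeff N T_L T_R i * (x.2 b * partialP b (partialP i (partialP i f)) x +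
          2 * (if b = i then partialP i (partialP b f) x else 0)) := by
    rw [P.generator_eq_fderiv_drift_add N T_L T_R hDd x]
    have h1 : fderiv ℝ (momDilation b f) x (P.drift N x) =
        x.2 b * fderiv ℝ (partialP b f) x (P.drift N x) +
          partialP b f x * (-partialQ b (P.hamiltonian N) x -
            P.γ * OscillatorChain.bathWeight N b * x.2 b) := by
      rw [hDdef, fderiv_mul (hmd x) (hgd x)]
      simp only [add_apply, _root_.smul_apply, smul_eq_mul, fderiv_momentum_coord]
      simp [OscillatorChain.drift]
    rw [h1]
    congr 1
    congr 1
    refine Finset.sum_congr rfl fun i _ => ?_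
    rw [show ((if i.val = 0 then T_L else 0) + if i.val = N - 1 then T_R else 0) =
        bathCoeff N T_L T_R i from rfl, hDii i, hthird i]
  -- `D_b (L f)` at `x`
  have hDL : momDilation b (P.generator N T_L T_R f) x =
      x.2 b * (fderiv ℝ (partialP b f) x (P.drift N x) +
        (partialQ b f x - P.γ * OscillatorChain.bathWeight N b * partialP b f x) +
        P.γ * ∑ i, bathCoeff N T_L T_R i * partialP b (partialP i (partialP i f)) x) := by
    unfold momDilation
    rw [hLf, Summit.AtomisticToContinuum.FouriersLaw.Theorems.OddSectorIrreversibility.partialP_add hF₁d (hF₂d.const_mul _), partialP_fderiv_drift P hU hV hf,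
      fderiv_apply_fderiv_drift_unitP P hU hV hfd, partialP_const_mul,
      partialP_fun_sum _ (fun i => (hfiid i).const_mul _)]
    congr 1
    congr 1
    congr 1
    refine Finset.sum_congr rfl fun i _ => ?_
    rw [partialP_const_mul]
  rw [hLD, hDL]
  unfold bathExchange
  simp only [Finset.mul_sum, mul_add, Finset.sum_add_distrib]
  rw [show ∑ i, P.γ * (bathCoeff N T_L T_R i *
      (2 * if b = i then partialP i (partialP b f) x else 0)) =
      P.γ * (bathCoeff N T_L T_R b * (2 * partialP b (partialP b f) x)) by
    rw [← Finset.mul_sum]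
    congr 1
    rw [Finset.sum_eq_single b]
    · simp
    · intro i _ hib
      simp [Ne.symm hib]
    · simp]
  ring

/-- ★ **The temperature derivative of the generator in DILATION FORM** (`N ≥ 2`, both
temperatures non-zero, smooth potentials, smooth `f`):
`(γ/2)(∂²_{p_L} − ∂²_{p_R}) f = (4T_L)⁻¹([L, D_L] f + 𝒜_L f) − (4T_R)⁻¹([L, D_R] f + 𝒜_R f)`,
every operator on the right being of FIRST order composed with `L`. [folklore] -/
theorem generator_temperature_deriv_eq_dilation (hN : 2 ≤ N) {T_L T_R : ℝ} (hTL : T_L ≠ 0)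
    (hTR : T_R ≠ 0) {f : PhaseSpace N → ℝ} (hf : ContDiff ℝ ∞ f) (x : PhaseSpace N) :
    P.γ * ∑ i, bathCoeff N (1 / 2) (-1 / 2) i * partialP i (partialP i f) x =
      (4 * T_L)⁻¹ * (P.generator N T_L T_R (momDilation (leftBath N hN) f) x -
          momDilation (leftBath N hN) (P.generator N T_L T_R f) x +
          bathExchange P N (leftBath N hN) f x) -
        (4 * T_R)⁻¹ * (P.generator N T_L T_R (momDilation (rightBath N hN) f) x -
          momDilation (rightBath N hN) (P.generator N T_L T_R f) x +
          bathExchange P N (rightBath N hN) f x) := by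
  rw [generator_momDilation_sub P hU hV T_L T_R hf (leftBath N hN) x,
    generator_momDilation_sub P hU hV T_L T_R hf (rightBath N hN) x,
    sum_bathCoeff_mul hN]
  have hL : bathCoeff N T_L T_R (leftBath N hN) = T_L := by
    have h1 : (0 : ℕ) ≠ N - 1 := by omega
    simp [bathCoeff, leftBath, h1]
  have hR : bathCoeff N T_L T_R (rightBath N hN) = T_R := by
    have h1 : N - 1 ≠ 0 := by omega
    simp [bathCoeff, rightBath, h1]
  rw [hL, hR]
  field_simp
  ring

/-- ★ **Infinitesimal form of (Dᵛ)**: `∂_δ L^{T+δ/2, T−δ/2} f (x)` at `δ = δ'` in dilation form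
(`T ± δ'/2 ≠ 0`; integrate along the `δ'`-semigroup — the commutator telescopes — to get the
dilation Duhamel `KernelTemperatureDilationDuhamel`). [folklore] -/
theorem hasDerivAt_generator_temperature_dilation (hN : 2 ≤ N) {T δ' : ℝ}
    (hL : T + δ' / 2 ≠ 0) (hR : T - δ' / 2 ≠ 0) {f : PhaseSpace N → ℝ} (hf : ContDiff ℝ ∞ f)
    (x : PhaseSpace N) :
    HasDerivAt (fun δ => P.generator N (T + δ / 2) (T - δ / 2) f x)
      ((4 * (T + δ' / 2))⁻¹ *
          (P.generator N (T + δ' / 2) (T - δ' / 2) (momDilation (leftBath N hN) f) x -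
            momDilation (leftBath N hN) (P.generator N (T + δ' / 2) (T - δ' / 2) f) x +
            bathExchange P N (leftBath N hN) f x) -
        (4 * (T - δ' / 2))⁻¹ *
          (P.generator N (T + δ' / 2) (T - δ' / 2) (momDilation (rightBath N hN) f) x -
            momDilation (rightBath N hN) (P.generator N (T + δ' / 2) (T - δ' / 2) f) x +
            bathExchange P N (rightBath N hN) f x)) δ' := by
  rw [← generator_temperature_deriv_eq_dilation P hU hV hN hL hR hf x]
  exact hasDerivAt_generator_temperature P N T f x δ'

end Commutator

end Summit.AtomisticToContinuum.FouriersLaw.Theorems.ExtensiveSnapshotIrreversibility.EnergyWindow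

end
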